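import Summits.BirchSwinnertonDyer.BirchSwinnertonDyer.Theorems.SignedLowerHalvesSprungLowerDivisibilityAtThreeStubPeriodMu
import Summits.BirchSwinnertonDyer.BirchSwinnertonDyer.Theorems.SignedLowerHalvesSprungLowerDivisibilityAtThreeBothColoursOfTraceFE
import Literature.NumberTheory.EllipticCurves.Sprung2012.SharpFlatColemanKatoZeta
import HarnessLib

/-!
# Crux `SprungLowerDivisibilityAtThree` (item stmt-BirchSwinnertonDyer-19875), line `chromatic-common-zeros`:
# CHROMATIC COPRIMALITY ALONE implies the v7 sporadic stub K_spor (class-wide), modulo the trace-coordinate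
# functional equation and the period unit — i.e. x8 child C1 ⟹ child C1′ without C3

Cell `bsd-ssimc` (host) / lead `cruxlead-stmt-BirchSwinnertonDyer-19875` (g2); `--supports` 19875 `--as helper`; theorems only; closes NO item;
K1 / BSD / leaf X8 are NOT proved by anything here.

v7 (lead g2) replaced the v6 pair {S0⁺ `stub_bothColours`, S2 `stub_chromaticCoprimality`} by the single colour-free stub K_spor
`stub_katoFineLowerSporadic` (Kato 2004 Conj. 12.10, Eisenstein half, at the sporadic COMMON zeros), with the bridge «(S0, S2) for a
pair ⇒ K_spor vacuous for that pair» (`ChromaticCommonZeros.not_sporadicCommonZero_of_coprimality`, p614828). Meanwhile w3 g2 proved S0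
CLASS-WIDE modulo ONE printed fact (`ChromaticBothColours.ClassX8.sharp_ne_zero_and_flat_ne_zero_of_traceFE`, p619288, from Sprung 2017
Thm. 1.1 + 4.13 `thm413_traceCoordinate_functionalEquation_three`, p617641). Hence S2 ALONE (= x8 child C1 `ChromaticCoprimalityX8`,
stmt-26781) implies K_spor (= x8 child C1′ `KatoFineLowerSporadicX8` of the W-81′ resplit) class-wide, modulo `hF` and the period unit
`h3` (for the normalised generators): `stub_katoFineLowerSporadic_of_chromaticCoprimality`. Vacuity argument: under S2 and both colours
non-zero, a height-one `𝔭 ∌ 3` without any `ω_n` cannot contain both normalised functions.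

References: [Sprung2015] Conj. 5.6; [Sprung2017] Thm. 1.1, Thm. 4.13, Conj. 4.12; [Kato2004Asterisque] Conj. 12.10 (p. 224); [GreenbergVatsal2000]
Rem. 3.4; tree `…BothColoursOfTraceFE` (p619288), `…StubPeriodMu` (p606253), `…KatoFineSporadic` (p614828).
-/

set_option linter.dupNamespace false
set_option autoImplicit false

noncomputable section

open scoped Classical NumberField MatrixGroups ModularForm

open NumberField IsDedekindDomain CongruenceSubgroup WeierstrassCurve Field
  Literature.NumberTheory.EllipticCurves Literature.NumberTheory.EllipticCurves.ModularForms
  Literature.NumberTheory.EllipticCurves.ZpExtension Literature.NumberTheory.EllipticCurves.Sprung2017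
  Literature.NumberTheory.EllipticCurves.Sprung2012 Literature.NumberTheory.EllipticCurves.Rank1Residual
  Literature.NumberTheory.EllipticCurves.IwasawaAlgebra Literature.NumberTheory.EllipticCurves.Kato2004
  Summit.BirchSwinnertonDyer.BirchSwinnertonDyer.Theorems

namespace Summit.BirchSwinnertonDyer.BirchSwinnertonDyer.Theorems.ChromaticCommonZeros

/-- **Chromatic coprimality (S2 / x8 C1) ⟹ the v7 sporadic stub K_spor (x8 C1′), class-wide**, modulo the trace-coordinate functional
equation `hF` (both colours non-zero on X8, w3's `ClassX8.sharp_ne_zero_and_flat_ne_zero_of_traceFE`) and the period unit `h3`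
(normalised generators exist, S3 (i)): the sporadic common-zero locus is EMPTY, so K_spor holds vacuously. `hS2` is the registered v6 stub
/ x8 child C1 signature VERBATIM; the conclusion is the registered v7 stub `stub_katoFineLowerSporadic` / x8 child C1′ signature VERBATIM.
CONDITIONAL (displayed); closes nothing. [cite: Sprung2015, Conj. 5.6] [cite: Sprung2017, Thm. 4.13 and Conj. 4.12]
[cite: Kato2004Asterisque, Conj. 12.10 (p. 224)] -/
theorem stub_katoFineLowerSporadic_of_chromaticCoprimality (h3 : realPeriodRat_eq_unit_mul_plusPeriod_three)
    (hF : thm413_traceCoordinate_functionalEquation_three)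
    (hS2 :
      ∀ (W : WeierstrassCurve ℚ) [W.IsElliptic] [W.IsGloballyMinimal] (p : ℕ) [Fact p.Prime],
        ClassX8 W p → ∀ (N : ℕ) (_ : NeZero N) (f : CuspForm (Gamma0 N) 2) (ϖ : ℚ)
          (Lsharp Lflat : IwasawaAlgebra p),
        IsNewformOf W f → (ϖ : ℝ) * W.realPeriodRat = plusPeriod f →
        IsSprungPair f p (W.frobeniusTrace p) Lsharp Lflat → Lsharp ≠ 0 → Lflat ≠ 0 →
      ∀ (Gs Gf : IwasawaAlgebra p),
        iwasawaToPowerSeries p Gs =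
          PowerSeries.C (ϖ : ℚ_[p]) * iwasawaToPowerSeries p (chromaticL Chroma.sharp Lsharp Lflat) →
        iwasawaToPowerSeries p Gf =
          PowerSeries.C (ϖ : ℚ_[p]) * iwasawaToPowerSeries p (chromaticL Chroma.flat Lsharp Lflat) →
      ∀ 𝔭 : PrimeSpectrum (IwasawaAlgebra p), 𝔭.asIdeal.height = 1 →
        Gs ∈ 𝔭.asIdeal → Gf ∈ 𝔭.asIdeal →
        (p : IwasawaAlgebra p) ∈ 𝔭.asIdeal ∨
          ∃ n : ℕ, ((cyclotomicOmega p n).map (Int.castRingHom ℤ_[p]) : PowerSeries ℤ_[p]) ∈ 𝔭.asIdeal) :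
    ∀ (W : WeierstrassCurve ℚ) [W.IsElliptic] [W.IsGloballyMinimal] (p : ℕ) [Fact p.Prime]
      [ContinuousSMul ℤ_[p] (W.tateModule p)] [Module.Free ℤ_[p] (W.tateModule p)]
      [Module.Finite ℤ_[p] (W.tateModule p)],
      ClassX8 W p → ∀ (κ : ZpExtension ℚ p) (γ : Field.absoluteGaloisGroup ℚ),
      κ.IsCyclotomic → κ.IsTopGenerator γ → IsCyclotomicVariable p γ →
    ∀ (v : HeightOneSpectrum (𝓞 ℚ)), (p : 𝓞 ℚ) ∈ v.asIdeal →
    ∀ (g : Field.absoluteGaloisGroup (v.adicCompletion ℚ)),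
      κ.IsTopGenerator (resGalOfEmb (closureEmb (K := ℚ) (v.adicCompletion ℚ)) g) →
    ∀ (cneg : localPoints W (v.adicCompletion ℚ)) (c : ℕ → localPoints W (v.adicCompletion ℚ)),
      IsHondaSystem κ (closureEmb (K := ℚ) (v.adicCompletion ℚ)) W (W.frobeniusTrace p) g cneg c →
    ∀ (N : ℕ) (_ : NeZero N) (f : CuspForm (Gamma0 N) 2) (ϖ : ℚ) (Lsharp Lflat : IwasawaAlgebra p),
      IsNewformOf W f → (ϖ : ℝ) * W.realPeriodRat = plusPeriod f →
      IsSprungPair f p (W.frobeniusTrace p) Lsharp Lflat →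
    ∀ (I : Kato2004.IwasawaH1Data W p κ γ)
      (Cs : SharpFlatColemanKatoData W p f ϖ κ γ (closureEmb (K := ℚ) (v.adicCompletion ℚ))
        (W.frobeniusTrace p) g c Chroma.sharp I)
      (Cf : SharpFlatColemanKatoData W p f ϖ κ γ (closureEmb (K := ℚ) (v.adicCompletion ℚ))
        (W.frobeniusTrace p) g c Chroma.flat I),
      Cs.Z = Cf.Z →
    ∀ (Y : W.FineSelmerDualData κ γ) (𝔭 : PrimeSpectrum (IwasawaAlgebra p)), 𝔭.asIdeal.height = 1 →
      (p : IwasawaAlgebra p) ∉ 𝔭.asIdeal →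
      (¬ ∃ n : ℕ, ((cyclotomicOmega p n).map (Int.castRingHom ℤ_[p]) : PowerSeries ℤ_[p]) ∈ 𝔭.asIdeal) →
      (∀ (col' : Chroma) (G' : IwasawaAlgebra p),
        iwasawaToPowerSeries p G' =
          PowerSeries.C (ϖ : ℚ_[p]) * iwasawaToPowerSeries p (chromaticL col' Lsharp Lflat) →
        G' ∈ 𝔭.asIdeal) →
      Module.lengthAt (IwasawaAlgebra p) (I.H ⧸ Cs.Z) 𝔭 ≤ Module.lengthAt (IwasawaAlgebra p) Y.X 𝔭 := by
  intro W _ _ p _ _ _ _ hX κ γ _ _ _ v _ g _ cneg c _ N hN f ϖ Lsharp Lflat hf hϖ hSP I Cs Cf _ Y 𝔭 h𝔭 hp𝔭 hcyc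
    hcommon
  exfalso
  -- both colours are non-zero (trace-coordinate functional equation) and normalised generators exist (period unit)
  obtain ⟨hLs, hLf⟩ := ChromaticBothColours.ClassX8.sharp_ne_zero_and_flat_ne_zero_of_traceFE hF W p hX N hN f Lsharp Lflat hf hSP
  obtain ⟨hGall, -⟩ := stub_periodMu h3 W p hX N hN f ϖ Lsharp Lflat hf hϖ hSP
  obtain ⟨Gs, hGs⟩ := hGall Chroma.sharp
  obtain ⟨Gf, hGf⟩ := hGall Chroma.flat
  -- chromatic coprimality at the common zero `𝔭` contradicts `3 ∉ 𝔭`, `ω_n ∉ 𝔭`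
  rcases hS2 W p hX N hN f ϖ Lsharp Lflat hf hϖ hSP hLs hLf Gs Gf hGs hGf 𝔭 h𝔭 (hcommon Chroma.sharp Gs hGs)
      (hcommon Chroma.flat Gf hGf) with h | h
  · exact hp𝔭 h
  · exact hcyc h

end Summit.BirchSwinnertonDyer.BirchSwinnertonDyer.Theorems.ChromaticCommonZeros

end
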